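import Summits.QuantumFields.BalabanUV.Beta.FP.StepLawKHolds
import Summits.QuantumFields.BalabanUV.Beta.GAN24.StencilSlotSAllThree
import Summits.QuantumFields.BalabanUV.Beta.GAN24.WSlotT2Tables

/-!
# `BalabanUV.Beta.FP.RoadPinnedHolds` — road «FP» for binder row D1: THE ROAD's END, ITS (STEP) SOCKET AND THE SYMMETRY INHERITANCE WITH THE
# (CONV-C) SLOT ROWS DISCHARGED BY NAME (`d = 3`, every `Lc ≥ 2`, adopted units) — the S-slot for EVERY second-order table family, the W-slot for the
# PINNED Stage-B family `JsBalT2Of … ((Lc:ℝ)^(2*(3+1))) cB Tc (hB_base …) (hmix_an1 … hr)`; the K-side went in `FP.StepLawKHolds`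

`RoadFromSlots` (gen 2) cut asym1's nine (CONV-C) binders of the road's END down to the S- and W-slot Cauchy rows; `StepLawKHolds` (gen 3) removed every K-side
binder for every `m`.  Row G-an2-4 has since delivered BY NAME, with NO hypothesis beyond `2 ≤ Lc` (and `r ∈ box (3+1) Lc`): the S-PAIR `(hS, hSall)` of
`JsBal0Of … W …` for EVERY table family `W` (`GAN24.StencilSlotSAllThree.hS_hSall_three`, gan24-p1 p209285, road «S3») and the W-PAIR `(hW, hWall)` for the PINNED
member `cE₂ := (Lc:ℝ)^(2*(3+1))` of an2's Stage-B family with an1's mixed table and the base border, `W := WbalOf 3 Lc cE cVH cΛ (T2Of 3 Lc cE cVH cΛ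
((Lc:ℝ)^(2*(3+1))) cB Tc (vh₂S 3 Lc) (mixFFAt (toSite r) Lc)) (mixFFAt (toSite r) Lc)` (`GAN24.WSlotT2Tables.hW_hWall_three_an1_pinned`, gan24-p1-g5 p217017, road
«W3»).  §1 plugs the S-pair in for a GENERIC `W` (only the W-slot rows stay); §2 plugs both pairs in for the pinned family, packaged as an2's `BalabanStepW2.JsBalT2Of`
(`= JsBalOf … (WbalOf …) (CwOf …) (δwOf …) (δwOf_pos …) (WbalOf_loc₂ …)` by `rfl`) — the family of the closing sentence `d1Drift_iff_three_JsBalT2Of_pinned`.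

RESULT (§2, the pinned family, `2 ≤ Lc`, `r ∈ box (3+1) Lc`): the wall family's one-loop kernel CONVERGES ENTRYWISE to the perfect one-step kernel
`TPerfOf Lc (KPerf …1) (SPerfOf … S 1) (WPerfOf … Wt 1)` given only the `m = 1` pins (`tendsto_TbalOf_JsBalT2Of_pinned`); the perfect one-step kernel inherits
(5.7) from an2's finite-`j` row hR ALONE and (5.9) from an1's finite-`j` row hW ALONE; and ROAD FP's END reads
`D1Drift Lc (JsBalT2Of …) N μ ν` ⟸ EXACTLY {hRj, hWj at finite `j` FOR THIS COMPOSITE FAMILY, the limit-currency class data of the free (j, m) jet families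
`S`, `Wt` for `m ≥ 2`, the fixed-point Fubini identity `hfub` + `hDA` (leaf N2a), (SDF)∞ `hSDF` (leaf N2b), the leading-log asymptotics `hasym` (leaf N7)} — no
K-, S- or W-slot row, no (CONV-C) binder of any currency.

HONEST FRAMING (cell contract, verbatim): «discharging `BetaPertH` makes Bałaban's UV stability UNCONDITIONAL — a real constructive-QFT result; it is NOT the
continuum limit and NOT the Clay problem.»  THIS MODULE IS A COMPOSITION over tree ENDs; it proves no estimate.  The (P6) decision that the `BetaPertH` wall
LITERAL is the pinned member is an2's / the leads' ((W-L-2), ref2 r73) and is NOT made here; the rows `hRj` / `hWj` are being proved by an2 / an1 for the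
RECURSIVE literal `JsRecWAtOf` (v2.26), NOT for this composite family (bridge = D1Tel, Q-G5-1 open) — here they are HYPOTHESES, displayed; N2a / N2b / N7 are
open leaves of road FP.  HEADLINE: «road FP's END for the pinned family needs nothing from row G-an2-4 any more» — NOT «D1 closed», NOT «G-an2-4 closed» (as
(CONV-C) for `G_k, H_k`), NOT BetaPertH, NOT continuum, NOT Clay; 0 wall binders instantiated at a value by this file; binders 0/4 (hW, hR, D1Tel, D1Rep).
Claim table `HOME/b2b-balaban-beta-d1-p3/LEAVES-FP.md` sub-row END-PINNED (unit `b2b-balaban-beta-d1-formalise-leaf-06`, gen 3).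
HONEST DEPENDENCY (verbatim): «continuum YM on T⁴ ⇐ BetaPertH ∧ nine spine estimates (0/9 proved); BetaPertH ⇐ (D1) ∧ (D4) ∧ CAP+tail; G-an2-4 gates asym,
D1 and NE2/3/4.»
ABSOLUTE RULE (cell, verbatim): «No internally-minted statement may enter as a cited fact. Every hypothesis is either kernel-proved in this package or a verbatim
quotation of a PUBLISHED theorem with page reference.»  Nothing is cited; no `def`; every input is a tree theorem imported BY NAME; nothing of gan24-p1's,
an2's or this lineage's earlier files is restated.
-/

namespace Summit.QuantumFields.BalabanUV.Beta.FP.RoadPinnedHolds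

open Filter Topology
open Literature.MathematicalPhysics.QuantumFieldTheory
open Literature.MathematicalPhysics.QuantumFieldTheory.Balaban1983to89
open Literature.MathematicalPhysics.QuantumFieldTheory.Balaban1983to89.Beta
open B12Beta (secondMoment)
open B12Normalization (stepBal)
open AffineAveraging (box toSite)
open DecimatedMomentSummable (AbsMoment₂)
open DressedMomentNormalisation (EKer dressedEntry)
open ExpKernelCalculus (MKer Decays VertexFamily₂)
open PolarizationSign (WardTransversal AxisReflectionCovariant)
open OneStepResolventKernel (Fib LocStencil)
open OneStepKernelFamily (KInvStep TbalOf flipK D1Drift)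
open BalabanStepJetsSucc (JsBal0Of JsBalOf)
open BalabanStepW2 (WbalOf T2Of T2Of_loc CwOf δwOf δwOf_pos WbalOf_loc₂ JsBalT2Of)
open AveragingMixedJetTables (vh₂S mixFFAt)
open FlowStep FlowStepRuns DagBinding
open RemainderChain (RemainderConst)
open Summit.QuantumFields.BalabanUV.Beta.HessKerDressedUnits (unitK unitS unitW)
open Summit.QuantumFields.BalabanUV.Beta.MixedJetTablesPlug (hmix_an1)
open Summit.QuantumFields.BalabanUV.Beta.GAN24.CombesThomas (sfStep smStep)
open Summit.QuantumFields.BalabanUV.Beta.GAN24.StencilSlotOfE3 (one_le_of_two_le)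
open Summit.QuantumFields.BalabanUV.Beta.GAN24.StencilSlotSAllThree (hS_hSall_three)
open Summit.QuantumFields.BalabanUV.Beta.GAN24.WSlotT2Tables (hB_base hW_hWall_three_an1_pinned)
open Summit.QuantumFields.BalabanUV.Beta.FP.PerfectObjectsT (KPerf SPerfOf WPerfOf TPerfOf fPerf)
open Summit.QuantumFields.BalabanUV.Beta.FP.TransportInfinityM (colOf)
open Summit.QuantumFields.BalabanUV.Beta.FP.SymmetryInheritHolds (tendsto_TbalOf_TPerfOf_one_holdsK axisReflectionCovariant_flipK_TPerfOf_one_holdsK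
  wardTransversal_flipK_TPerfOf_one_holdsK)
open Summit.QuantumFields.BalabanUV.Beta.FP.StepLawKHolds (fPerf_succ_of_rows_holdsK d1Drift_JsBalOf_of_rows_bounded endpointExistence_of_rows_bounded)

noncomputable section

variable {Lc : ℕ} [NeZero Lc]

/-! ## §1 Generic second-order tables `W`: the S-slot rows discharged (gan24-p1 `hS_hSall_three`), the W-slot rows kept -/

section GenericW

variable (hLc : 1 ≤ Lc) (cE cVH cΛ : ℝ)
  (W : ℕ → Fin (3 + 1) → (Fin (3 + 1) → ℤ) → Fin (3 + 1) → (Fin (3 + 1) → ℤ) → MKer (3 + 1) (Fib 3))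
  (Cw' δw : ℕ → ℝ) (hδw : ∀ j, 0 < δw j) (hW' : ∀ j, VertexFamily₂ (W j) Lc (Cw' j) (δw j))
  (S : ℕ → ℕ → Fin (3 + 1) → (Fin (3 + 1) → ℤ) → MKer (3 + 1) (Fib 3))
  (Wt : ℕ → ℕ → Fin (3 + 1) → (Fin (3 + 1) → ℤ) → Fin (3 + 1) → (Fin (3 + 1) → ℤ) → MKer (3 + 1) (Fib 3))
  {Cw cW δW θW : ℝ} {D : ℕ → EKer 4}

/-- **THE WALL FAMILY CONVERGES ENTRYWISE TO THE PERFECT ONE-STEP KERNEL — K- AND S-ROWS DISCHARGED** (`d = 3`, `2 ≤ Lc`, adopted units): given only the W-slot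
Cauchy rows (`hW`, `hWall`, rate `θW ∈ [0,1)`, decay `δW > 0`) and the `m = 1` pins, `TbalOf Lc (JsBalOf …) j μ ν x → TPerfOf Lc (KPerf …1) (SPerfOf …1) (WPerfOf …1) μ ν x` —
`SymmetryInheritHolds.tendsto_TbalOf_TPerfOf_one_holdsK` with `(hS, hSall)` := `StencilSlotSAllThree.hS_hSall_three`. [our object] -/
theorem tendsto_TbalOf_TPerfOf_one_holdsKS (hLc2 : 2 ≤ Lc)
    (hS1 : ∀ j, S j 1 = (JsBal0Of hLc cE cVH cΛ W Cw' δw hδw hW' j).S) (hW1 : ∀ j, Wt j 1 = W j)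
    (hW : ∀ j, VertexFamily₂ (unitW (sfStep Lc j) (smStep 3 Lc j) (W j)) Lc Cw δW)
    (hWall : ∀ k j, VertexFamily₂ (unitW (sfStep Lc (k + j)) (smStep 3 Lc (k + j)) (W (k + j)) - unitW (sfStep Lc k) (smStep 3 Lc k) (W k)) Lc
      (cW * θW ^ k) δW)
    (hδW : 0 < δW) (hθW0 : 0 ≤ θW) (hθW1 : θW < 1) (μ ν : Fin 4) (x : Fin 4 → ℤ) :
    Tendsto (fun j => TbalOf Lc (JsBalOf hLc cE cVH cΛ W Cw' δw hδw hW') j μ ν x) atTop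
      (𝓝 (TPerfOf Lc (KPerf (d := 3) Lc (sfStep Lc) (smStep 3 Lc) 1) (SPerfOf (sfStep Lc) (smStep 3 Lc) S 1)
        (WPerfOf (sfStep Lc) (smStep 3 Lc) Wt 1) μ ν x)) := by
  obtain ⟨Cs, cS, θS, δS, hθS0, hθS1, hδS, hS, hSall⟩ := hS_hSall_three hLc2 cE cVH cΛ W Cw' δw hδw hW'
  exact tendsto_TbalOf_TPerfOf_one_holdsK hLc cE cVH cΛ W Cw' δw hδw hW' S Wt hLc2 hS1 hW1 hS hSall hW hWall hδS hδW hθS0 hθS1 hθW0 hθW1 μ ν x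

/-- **(5.7) OF THE PERFECT ONE-STEP KERNEL FROM an2's ROW hR, K- AND S-ROWS DISCHARGED**: the W-slot rows + the pins + `hRj` ⟹
`AxisReflectionCovariant (flipK (TPerfOf Lc (KPerf …1) (SPerfOf …1) (WPerfOf …1)))`. [our object] -/
theorem axisReflectionCovariant_flipK_TPerfOf_one_holdsKS (hLc2 : 2 ≤ Lc)
    (hS1 : ∀ j, S j 1 = (JsBal0Of hLc cE cVH cΛ W Cw' δw hδw hW' j).S) (hW1 : ∀ j, Wt j 1 = W j)
    (hW : ∀ j, VertexFamily₂ (unitW (sfStep Lc j) (smStep 3 Lc j) (W j)) Lc Cw δW)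
    (hWall : ∀ k j, VertexFamily₂ (unitW (sfStep Lc (k + j)) (smStep 3 Lc (k + j)) (W (k + j)) - unitW (sfStep Lc k) (smStep 3 Lc k) (W k)) Lc
      (cW * θW ^ k) δW)
    (hδW : 0 < δW) (hθW0 : 0 ≤ θW) (hθW1 : θW < 1)
    (hRj : ∀ j, AxisReflectionCovariant (flipK (TbalOf Lc (JsBalOf hLc cE cVH cΛ W Cw' δw hδw hW') j))) :
    AxisReflectionCovariant (flipK (TPerfOf Lc (KPerf (d := 3) Lc (sfStep Lc) (smStep 3 Lc) 1) (SPerfOf (sfStep Lc) (smStep 3 Lc) S 1)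
      (WPerfOf (sfStep Lc) (smStep 3 Lc) Wt 1))) := by
  obtain ⟨Cs, cS, θS, δS, hθS0, hθS1, hδS, hS, hSall⟩ := hS_hSall_three hLc2 cE cVH cΛ W Cw' δw hδw hW'
  exact axisReflectionCovariant_flipK_TPerfOf_one_holdsK hLc cE cVH cΛ W Cw' δw hδw hW' S Wt hLc2 hS1 hW1 hS hSall hW hWall hδS hδW hθS0 hθS1 hθW0
    hθW1 hRj

/-- **(5.9) OF THE PERFECT ONE-STEP KERNEL FROM an1's ROW hW, K- AND S-ROWS DISCHARGED**: the W-slot rows + the pins + `hWj` ⟹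
`WardTransversal (flipK (TPerfOf Lc (KPerf …1) (SPerfOf …1) (WPerfOf …1)))`. [our object] -/
theorem wardTransversal_flipK_TPerfOf_one_holdsKS (hLc2 : 2 ≤ Lc)
    (hS1 : ∀ j, S j 1 = (JsBal0Of hLc cE cVH cΛ W Cw' δw hδw hW' j).S) (hW1 : ∀ j, Wt j 1 = W j)
    (hW : ∀ j, VertexFamily₂ (unitW (sfStep Lc j) (smStep 3 Lc j) (W j)) Lc Cw δW)
    (hWall : ∀ k j, VertexFamily₂ (unitW (sfStep Lc (k + j)) (smStep 3 Lc (k + j)) (W (k + j)) - unitW (sfStep Lc k) (smStep 3 Lc k) (W k)) Lc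
      (cW * θW ^ k) δW)
    (hδW : 0 < δW) (hθW0 : 0 ≤ θW) (hθW1 : θW < 1)
    (hWj : ∀ j, WardTransversal (flipK (TbalOf Lc (JsBalOf hLc cE cVH cΛ W Cw' δw hδw hW') j))) :
    WardTransversal (flipK (TPerfOf Lc (KPerf (d := 3) Lc (sfStep Lc) (smStep 3 Lc) 1) (SPerfOf (sfStep Lc) (smStep 3 Lc) S 1)
      (WPerfOf (sfStep Lc) (smStep 3 Lc) Wt 1))) := by
  obtain ⟨Cs, cS, θS, δS, hθS0, hθS1, hδS, hS, hSall⟩ := hS_hSall_three hLc2 cE cVH cΛ W Cw' δw hδw hW'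
  exact wardTransversal_flipK_TPerfOf_one_holdsK hLc cE cVH cΛ W Cw' δw hδw hW' S Wt hLc2 hS1 hW1 hS hSall hW hWall hδS hδW hθS0 hθS1 hθW0 hθW1 hWj

/-- **THE STEP LAW OF THE PERFECT COEFFICIENT FAMILY FROM THE WALL's ROWS, K-SIDE AND S-SLOT DISCHARGED** (`d = 3`, `2 ≤ Lc`, adopted units):
`StepLawKHolds.fPerf_succ_of_rows_holdsK` with `(hS, hSall)` := `hS_hSall_three`.  REMAINING (displayed): the `m = 1` pins, the W-slot Cauchy rows, `hRj`/`hWj`,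
class data of the perfect stencils / tables for `m ≥ 2`, Fubini∞ `hfub` + `hDA`, (SDF)∞ `hSDF`. [our object] -/
theorem fPerf_succ_of_rows_holdsKS (hLc2 : 2 ≤ Lc)
    (hS1 : ∀ j, S j 1 = (JsBal0Of hLc cE cVH cΛ W Cw' δw hδw hW' j).S) (hW1 : ∀ j, Wt j 1 = W j)
    (hW : ∀ j, VertexFamily₂ (unitW (sfStep Lc j) (smStep 3 Lc j) (W j)) Lc Cw δW)
    (hWall : ∀ k j, VertexFamily₂ (unitW (sfStep Lc (k + j)) (smStep 3 Lc (k + j)) (W (k + j)) - unitW (sfStep Lc k) (smStep 3 Lc k) (W k)) Lc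
      (cW * θW ^ k) δW)
    (hδW : 0 < δW) (hθW0 : 0 ≤ θW) (hθW1 : θW < 1)
    (hRj : ∀ j, AxisReflectionCovariant (flipK (TbalOf Lc (JsBalOf hLc cE cVH cΛ W Cw' δw hδw hW') j)))
    (hWj : ∀ j, WardTransversal (flipK (TbalOf Lc (JsBalOf hLc cE cVH cΛ W Cw' δw hδw hW') j)))
    (hSinf : ∀ m : ℕ, 2 ≤ m → ∃ Cs' δS' : ℝ, 0 < δS' ∧ LocStencil (SPerfOf (sfStep Lc) (smStep 3 Lc) S m) Cs' δS')
    (hWinf : ∀ m : ℕ, 2 ≤ m → ∃ Cw'' δW' : ℝ, 0 < δW' ∧ VertexFamily₂ (WPerfOf (sfStep Lc) (smStep 3 Lc) Wt m) (Lc ^ m) Cw'' δW')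
    (hDA : ∀ m : ℕ, 1 ≤ m → ∀ a b, AbsMoment₂ (D m a b))
    (hfub : ∀ m : ℕ, 1 ≤ m → ∀ (a b : Fin 4) (z : Fin 4 → ℤ),
      TPerfOf (Lc ^ (m + 1)) (KPerf Lc (sfStep Lc) (smStep 3 Lc) (m + 1)) (SPerfOf (sfStep Lc) (smStep 3 Lc) S (m + 1))
          (WPerfOf (sfStep Lc) (smStep 3 Lc) Wt (m + 1)) a b z
        = ((Lc ^ m : ℕ) : ℝ) ^ 8 * dressedEntry (colOf (KPerf (d := 3) Lc (sfStep Lc) (smStep 3 Lc) m))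
            (TPerfOf Lc (KPerf Lc (sfStep Lc) (smStep 3 Lc) 1) (SPerfOf (sfStep Lc) (smStep 3 Lc) S 1) (WPerfOf (sfStep Lc) (smStep 3 Lc) Wt 1))
            (((Lc ^ m : ℕ) : ℤ) • z) a b
          + TPerfOf (Lc ^ m) (KPerf Lc (sfStep Lc) (smStep 3 Lc) m) (SPerfOf (sfStep Lc) (smStep 3 Lc) S m) (WPerfOf (sfStep Lc) (smStep 3 Lc) Wt m) a b z
          + D m a b z)
    (μ ν : Fin 4) (hSDF : ∀ m : ℕ, 1 ≤ m → secondMoment (D m) μ ν = 0) :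
    ∀ m : ℕ, 1 ≤ m → fPerf Lc (sfStep Lc) (smStep 3 Lc) S Wt μ ν (m + 1) =
      fPerf Lc (sfStep Lc) (smStep 3 Lc) S Wt μ ν m + fPerf Lc (sfStep Lc) (smStep 3 Lc) S Wt μ ν 1 := by
  obtain ⟨Cs, cS, θS, δS, hθS0, hθS1, hδS, hS, hSall⟩ := hS_hSall_three hLc2 cE cVH cΛ W Cw' δw hδw hW'
  exact fPerf_succ_of_rows_holdsK hLc cE cVH cΛ W Cw' δw hδw hW' S Wt hLc2 hS1 hW1 hS hSall hW hWall hδS hδW hθS0 hθS1 hθW0 hθW1 hRj hWj hSinf hWinf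
    hDA hfub μ ν hSDF

/-- **ROAD «FP», THE END FROM THE WALL's ROWS, K-SIDE AND S-SLOT DISCHARGED (bounded-defect form)**: `StepLawKHolds.d1Drift_JsBalOf_of_rows_bounded` with
`(hS, hSall)` := `hS_hSall_three`.  HYPOTHESES (displayed): W-slot rows + pins, `hRj`/`hWj`, class data (`m ≥ 2`), `hfub` + `hDA`, `hSDF`, `hasym`. [our object] -/
theorem d1Drift_JsBalOf_of_rows_bounded_holdsKS (hLc2 : 2 ≤ Lc)
    (hS1 : ∀ j, S j 1 = (JsBal0Of hLc cE cVH cΛ W Cw' δw hδw hW' j).S) (hW1 : ∀ j, Wt j 1 = W j)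
    (hW : ∀ j, VertexFamily₂ (unitW (sfStep Lc j) (smStep 3 Lc j) (W j)) Lc Cw δW)
    (hWall : ∀ k j, VertexFamily₂ (unitW (sfStep Lc (k + j)) (smStep 3 Lc (k + j)) (W (k + j)) - unitW (sfStep Lc k) (smStep 3 Lc k) (W k)) Lc
      (cW * θW ^ k) δW)
    (hδW : 0 < δW) (hθW0 : 0 ≤ θW) (hθW1 : θW < 1)
    (hRj : ∀ j, AxisReflectionCovariant (flipK (TbalOf Lc (JsBalOf hLc cE cVH cΛ W Cw' δw hδw hW') j)))
    (hWj : ∀ j, WardTransversal (flipK (TbalOf Lc (JsBalOf hLc cE cVH cΛ W Cw' δw hδw hW') j)))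
    (hSinf : ∀ m : ℕ, 2 ≤ m → ∃ Cs' δS' : ℝ, 0 < δS' ∧ LocStencil (SPerfOf (sfStep Lc) (smStep 3 Lc) S m) Cs' δS')
    (hWinf : ∀ m : ℕ, 2 ≤ m → ∃ Cw'' δW' : ℝ, 0 < δW' ∧ VertexFamily₂ (WPerfOf (sfStep Lc) (smStep 3 Lc) Wt m) (Lc ^ m) Cw'' δW')
    (hDA : ∀ m : ℕ, 1 ≤ m → ∀ a b, AbsMoment₂ (D m a b))
    (hfub : ∀ m : ℕ, 1 ≤ m → ∀ (a b : Fin 4) (z : Fin 4 → ℤ),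
      TPerfOf (Lc ^ (m + 1)) (KPerf Lc (sfStep Lc) (smStep 3 Lc) (m + 1)) (SPerfOf (sfStep Lc) (smStep 3 Lc) S (m + 1))
          (WPerfOf (sfStep Lc) (smStep 3 Lc) Wt (m + 1)) a b z
        = ((Lc ^ m : ℕ) : ℝ) ^ 8 * dressedEntry (colOf (KPerf (d := 3) Lc (sfStep Lc) (smStep 3 Lc) m))
            (TPerfOf Lc (KPerf Lc (sfStep Lc) (smStep 3 Lc) 1) (SPerfOf (sfStep Lc) (smStep 3 Lc) S 1) (WPerfOf (sfStep Lc) (smStep 3 Lc) Wt 1))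
            (((Lc ^ m : ℕ) : ℤ) • z) a b
          + TPerfOf (Lc ^ m) (KPerf Lc (sfStep Lc) (smStep 3 Lc) m) (SPerfOf (sfStep Lc) (smStep 3 Lc) S m) (WPerfOf (sfStep Lc) (smStep 3 Lc) Wt m) a b z
          + D m a b z)
    (μ ν : Fin 4) (hSDF : ∀ m : ℕ, 1 ≤ m → secondMoment (D m) μ ν = 0) {N Cg : ℝ}
    (hasym : ∀ m : ℕ, 1 ≤ m → |fPerf Lc (sfStep Lc) (smStep 3 Lc) S Wt μ ν m - (m : ℝ) * stepBal N Lc| ≤ Cg) :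
    D1Drift Lc (JsBalOf hLc cE cVH cΛ W Cw' δw hδw hW') N μ ν := by
  obtain ⟨Cs, cS, θS, δS, hθS0, hθS1, hδS, hS, hSall⟩ := hS_hSall_three hLc2 cE cVH cΛ W Cw' δw hδw hW'
  exact d1Drift_JsBalOf_of_rows_bounded hLc cE cVH cΛ W Cw' δw hδw hW' S Wt hLc2 hS1 hW1 hS hSall hW hWall hδS hδW hθS0 hθS1 hθW0 hθW1 hRj hWj hSinf
    hWinf hDA hfub μ ν hSDF hasym

end GenericW

/-! ## §2 The PINNED Stage-B family `JsBalT2Of … ((Lc:ℝ)^(2*(3+1))) cB Tc (hB_base …) (hmix_an1 … hr)`: K-, S- AND W-slot rows all discharged -/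

section Pinned

variable {r : Fin (3 + 1) → ℕ} (hr : r ∈ box (3 + 1) Lc) (cE cVH cΛ cB : ℝ) (Tc : Fin 4 → Fin 4 → Fin 4 → Fin 4 → ℝ)
  (S : ℕ → ℕ → Fin (3 + 1) → (Fin (3 + 1) → ℤ) → MKer (3 + 1) (Fib 3))
  (Wt : ℕ → ℕ → Fin (3 + 1) → (Fin (3 + 1) → ℤ) → Fin (3 + 1) → (Fin (3 + 1) → ℤ) → MKer (3 + 1) (Fib 3))
  {D : ℕ → EKer 4}

/-- **THE PINNED WALL FAMILY's ONE-LOOP KERNEL CONVERGES ENTRYWISE TO THE PERFECT ONE-STEP KERNEL — NO ANALYTIC HYPOTHESIS** (`d = 3`, `2 ≤ Lc`,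
`r ∈ box (3+1) Lc`): for an2's Stage-B family at `cE₂ := (Lc:ℝ)^(2*(3+1))` with an1's mixed table and the base border, packaged as `JsBalT2Of`, and ANY (j, m)
jet families `S`, `Wt` pinned at `m = 1` to the family's first- and second-order tables,
`TbalOf Lc (JsBalT2Of …) j μ ν x → TPerfOf Lc (KPerf …1) (SPerfOf … S 1) (WPerfOf … Wt 1) μ ν x` as `j → ∞` — K-rows `convCKWall_holds`, S-rows `hS_hSall_three`,
W-rows `hW_hWall_three_an1_pinned`, BY NAME. [our object] -/
theorem tendsto_TbalOf_JsBalT2Of_pinned (hLc2 : 2 ≤ Lc)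
    (hS1 : ∀ j, S j 1 = (JsBal0Of (one_le_of_two_le hLc2) cE cVH cΛ
      (WbalOf 3 Lc cE cVH cΛ (T2Of 3 Lc cE cVH cΛ ((Lc : ℝ) ^ (2 * (3 + 1))) cB Tc (vh₂S 3 Lc) (mixFFAt (toSite r) Lc)) (mixFFAt (toSite r) Lc))
      (CwOf (one_le_of_two_le hLc2) cE cVH cΛ (T2Of_loc (one_le_of_two_le hLc2) cE cVH cΛ ((Lc : ℝ) ^ (2 * (3 + 1))) cB Tc
        (hB_base (one_le_of_two_le hLc2)) (hmix_an1 (one_le_of_two_le hLc2) hr)) (hmix_an1 (one_le_of_two_le hLc2) hr))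
      (δwOf (one_le_of_two_le hLc2) cE cVH cΛ (T2Of_loc (one_le_of_two_le hLc2) cE cVH cΛ ((Lc : ℝ) ^ (2 * (3 + 1))) cB Tc
        (hB_base (one_le_of_two_le hLc2)) (hmix_an1 (one_le_of_two_le hLc2) hr)) (hmix_an1 (one_le_of_two_le hLc2) hr))
      (δwOf_pos (one_le_of_two_le hLc2) cE cVH cΛ (T2Of_loc (one_le_of_two_le hLc2) cE cVH cΛ ((Lc : ℝ) ^ (2 * (3 + 1))) cB Tc
        (hB_base (one_le_of_two_le hLc2)) (hmix_an1 (one_le_of_two_le hLc2) hr)) (hmix_an1 (one_le_of_two_le hLc2) hr))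
      (WbalOf_loc₂ (one_le_of_two_le hLc2) cE cVH cΛ (T2Of_loc (one_le_of_two_le hLc2) cE cVH cΛ ((Lc : ℝ) ^ (2 * (3 + 1))) cB Tc
        (hB_base (one_le_of_two_le hLc2)) (hmix_an1 (one_le_of_two_le hLc2) hr)) (hmix_an1 (one_le_of_two_le hLc2) hr)) j).S)
    (hW1 : ∀ j, Wt j 1 = WbalOf 3 Lc cE cVH cΛ (T2Of 3 Lc cE cVH cΛ ((Lc : ℝ) ^ (2 * (3 + 1))) cB Tc (vh₂S 3 Lc) (mixFFAt (toSite r) Lc))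
      (mixFFAt (toSite r) Lc) j)
    (μ ν : Fin 4) (x : Fin 4 → ℤ) :
    Tendsto (fun j => TbalOf Lc (JsBalT2Of (one_le_of_two_le hLc2) cE cVH cΛ ((Lc : ℝ) ^ (2 * (3 + 1))) cB Tc
        (hB_base (one_le_of_two_le hLc2)) (hmix_an1 (one_le_of_two_le hLc2) hr)) j μ ν x) atTop
      (𝓝 (TPerfOf Lc (KPerf (d := 3) Lc (sfStep Lc) (smStep 3 Lc) 1) (SPerfOf (sfStep Lc) (smStep 3 Lc) S 1)
        (WPerfOf (sfStep Lc) (smStep 3 Lc) Wt 1) μ ν x)) := by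
  obtain ⟨Cw, cW, θW, δW, hθW0, hθW1, hδW, hW, hWall⟩ := hW_hWall_three_an1_pinned hLc2 hr cE cVH cΛ cB Tc
  exact tendsto_TbalOf_TPerfOf_one_holdsKS (one_le_of_two_le hLc2) cE cVH cΛ _ _ _ _ _ S Wt hLc2 hS1 hW1 hW hWall hδW hθW0 hθW1 μ ν x

/-- **(5.7) OF THE PERFECT ONE-STEP KERNEL FROM an2's ROW hR ALONE, for the pinned family**: `hRj` (finite `j`, THIS composite family) + the pins ⟹
`AxisReflectionCovariant (flipK (TPerfOf Lc (KPerf …1) (SPerfOf … S 1) (WPerfOf … Wt 1)))`. [our object] -/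
theorem axisReflectionCovariant_flipK_TPerfOf_one_pinned (hLc2 : 2 ≤ Lc)
    (hS1 : ∀ j, S j 1 = (JsBal0Of (one_le_of_two_le hLc2) cE cVH cΛ
      (WbalOf 3 Lc cE cVH cΛ (T2Of 3 Lc cE cVH cΛ ((Lc : ℝ) ^ (2 * (3 + 1))) cB Tc (vh₂S 3 Lc) (mixFFAt (toSite r) Lc)) (mixFFAt (toSite r) Lc))
      (CwOf (one_le_of_two_le hLc2) cE cVH cΛ (T2Of_loc (one_le_of_two_le hLc2) cE cVH cΛ ((Lc : ℝ) ^ (2 * (3 + 1))) cB Tc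
        (hB_base (one_le_of_two_le hLc2)) (hmix_an1 (one_le_of_two_le hLc2) hr)) (hmix_an1 (one_le_of_two_le hLc2) hr))
      (δwOf (one_le_of_two_le hLc2) cE cVH cΛ (T2Of_loc (one_le_of_two_le hLc2) cE cVH cΛ ((Lc : ℝ) ^ (2 * (3 + 1))) cB Tc
        (hB_base (one_le_of_two_le hLc2)) (hmix_an1 (one_le_of_two_le hLc2) hr)) (hmix_an1 (one_le_of_two_le hLc2) hr))
      (δwOf_pos (one_le_of_two_le hLc2) cE cVH cΛ (T2Of_loc (one_le_of_two_le hLc2) cE cVH cΛ ((Lc : ℝ) ^ (2 * (3 + 1))) cB Tc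
        (hB_base (one_le_of_two_le hLc2)) (hmix_an1 (one_le_of_two_le hLc2) hr)) (hmix_an1 (one_le_of_two_le hLc2) hr))
      (WbalOf_loc₂ (one_le_of_two_le hLc2) cE cVH cΛ (T2Of_loc (one_le_of_two_le hLc2) cE cVH cΛ ((Lc : ℝ) ^ (2 * (3 + 1))) cB Tc
        (hB_base (one_le_of_two_le hLc2)) (hmix_an1 (one_le_of_two_le hLc2) hr)) (hmix_an1 (one_le_of_two_le hLc2) hr)) j).S)
    (hW1 : ∀ j, Wt j 1 = WbalOf 3 Lc cE cVH cΛ (T2Of 3 Lc cE cVH cΛ ((Lc : ℝ) ^ (2 * (3 + 1))) cB Tc (vh₂S 3 Lc) (mixFFAt (toSite r) Lc))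
      (mixFFAt (toSite r) Lc) j)
    (hRj : ∀ j, AxisReflectionCovariant (flipK (TbalOf Lc (JsBalT2Of (one_le_of_two_le hLc2) cE cVH cΛ ((Lc : ℝ) ^ (2 * (3 + 1))) cB Tc
      (hB_base (one_le_of_two_le hLc2)) (hmix_an1 (one_le_of_two_le hLc2) hr)) j))) :
    AxisReflectionCovariant (flipK (TPerfOf Lc (KPerf (d := 3) Lc (sfStep Lc) (smStep 3 Lc) 1) (SPerfOf (sfStep Lc) (smStep 3 Lc) S 1)
      (WPerfOf (sfStep Lc) (smStep 3 Lc) Wt 1))) := by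
  obtain ⟨Cw, cW, θW, δW, hθW0, hθW1, hδW, hW, hWall⟩ := hW_hWall_three_an1_pinned hLc2 hr cE cVH cΛ cB Tc
  exact axisReflectionCovariant_flipK_TPerfOf_one_holdsKS (one_le_of_two_le hLc2) cE cVH cΛ _ _ _ _ _ S Wt hLc2 hS1 hW1 hW hWall hδW hθW0 hθW1 hRj

/-- **(5.9) OF THE PERFECT ONE-STEP KERNEL FROM an1's ROW hW ALONE, for the pinned family**: `hWj` (finite `j`, THIS composite family) + the pins ⟹
`WardTransversal (flipK (TPerfOf Lc (KPerf …1) (SPerfOf … S 1) (WPerfOf … Wt 1)))`. [our object] -/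
theorem wardTransversal_flipK_TPerfOf_one_pinned (hLc2 : 2 ≤ Lc)
    (hS1 : ∀ j, S j 1 = (JsBal0Of (one_le_of_two_le hLc2) cE cVH cΛ
      (WbalOf 3 Lc cE cVH cΛ (T2Of 3 Lc cE cVH cΛ ((Lc : ℝ) ^ (2 * (3 + 1))) cB Tc (vh₂S 3 Lc) (mixFFAt (toSite r) Lc)) (mixFFAt (toSite r) Lc))
      (CwOf (one_le_of_two_le hLc2) cE cVH cΛ (T2Of_loc (one_le_of_two_le hLc2) cE cVH cΛ ((Lc : ℝ) ^ (2 * (3 + 1))) cB Tc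
        (hB_base (one_le_of_two_le hLc2)) (hmix_an1 (one_le_of_two_le hLc2) hr)) (hmix_an1 (one_le_of_two_le hLc2) hr))
      (δwOf (one_le_of_two_le hLc2) cE cVH cΛ (T2Of_loc (one_le_of_two_le hLc2) cE cVH cΛ ((Lc : ℝ) ^ (2 * (3 + 1))) cB Tc
        (hB_base (one_le_of_two_le hLc2)) (hmix_an1 (one_le_of_two_le hLc2) hr)) (hmix_an1 (one_le_of_two_le hLc2) hr))
      (δwOf_pos (one_le_of_two_le hLc2) cE cVH cΛ (T2Of_loc (one_le_of_two_le hLc2) cE cVH cΛ ((Lc : ℝ) ^ (2 * (3 + 1))) cB Tc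
        (hB_base (one_le_of_two_le hLc2)) (hmix_an1 (one_le_of_two_le hLc2) hr)) (hmix_an1 (one_le_of_two_le hLc2) hr))
      (WbalOf_loc₂ (one_le_of_two_le hLc2) cE cVH cΛ (T2Of_loc (one_le_of_two_le hLc2) cE cVH cΛ ((Lc : ℝ) ^ (2 * (3 + 1))) cB Tc
        (hB_base (one_le_of_two_le hLc2)) (hmix_an1 (one_le_of_two_le hLc2) hr)) (hmix_an1 (one_le_of_two_le hLc2) hr)) j).S)
    (hW1 : ∀ j, Wt j 1 = WbalOf 3 Lc cE cVH cΛ (T2Of 3 Lc cE cVH cΛ ((Lc : ℝ) ^ (2 * (3 + 1))) cB Tc (vh₂S 3 Lc) (mixFFAt (toSite r) Lc))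
      (mixFFAt (toSite r) Lc) j)
    (hWj : ∀ j, WardTransversal (flipK (TbalOf Lc (JsBalT2Of (one_le_of_two_le hLc2) cE cVH cΛ ((Lc : ℝ) ^ (2 * (3 + 1))) cB Tc
      (hB_base (one_le_of_two_le hLc2)) (hmix_an1 (one_le_of_two_le hLc2) hr)) j))) :
    WardTransversal (flipK (TPerfOf Lc (KPerf (d := 3) Lc (sfStep Lc) (smStep 3 Lc) 1) (SPerfOf (sfStep Lc) (smStep 3 Lc) S 1)
      (WPerfOf (sfStep Lc) (smStep 3 Lc) Wt 1))) := by
  obtain ⟨Cw, cW, θW, δW, hθW0, hθW1, hδW, hW, hWall⟩ := hW_hWall_three_an1_pinned hLc2 hr cE cVH cΛ cB Tc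
  exact wardTransversal_flipK_TPerfOf_one_holdsKS (one_le_of_two_le hLc2) cE cVH cΛ _ _ _ _ _ S Wt hLc2 hS1 hW1 hW hWall hδW hθW0 hθW1 hWj

/-- **THE STEP LAW OF THE PERFECT COEFFICIENT FAMILY FROM THE PINNED WALL FAMILY's ROWS, K-, S- AND W-ROWS DISCHARGED**: `fPerf_succ_of_rows_holdsKS` with
`(hW, hWall)` := `hW_hWall_three_an1_pinned`.  REMAINING (displayed): the `m = 1` pins, `hRj`/`hWj` for THIS family, class data of the perfect stencils / tables
for `m ≥ 2`, Fubini∞ `hfub` + `hDA` (N2a), (SDF)∞ `hSDF` (N2b). [our object] -/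
theorem fPerf_succ_of_rows_pinned (hLc2 : 2 ≤ Lc)
    (hS1 : ∀ j, S j 1 = (JsBal0Of (one_le_of_two_le hLc2) cE cVH cΛ
      (WbalOf 3 Lc cE cVH cΛ (T2Of 3 Lc cE cVH cΛ ((Lc : ℝ) ^ (2 * (3 + 1))) cB Tc (vh₂S 3 Lc) (mixFFAt (toSite r) Lc)) (mixFFAt (toSite r) Lc))
      (CwOf (one_le_of_two_le hLc2) cE cVH cΛ (T2Of_loc (one_le_of_two_le hLc2) cE cVH cΛ ((Lc : ℝ) ^ (2 * (3 + 1))) cB Tc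
        (hB_base (one_le_of_two_le hLc2)) (hmix_an1 (one_le_of_two_le hLc2) hr)) (hmix_an1 (one_le_of_two_le hLc2) hr))
      (δwOf (one_le_of_two_le hLc2) cE cVH cΛ (T2Of_loc (one_le_of_two_le hLc2) cE cVH cΛ ((Lc : ℝ) ^ (2 * (3 + 1))) cB Tc
        (hB_base (one_le_of_two_le hLc2)) (hmix_an1 (one_le_of_two_le hLc2) hr)) (hmix_an1 (one_le_of_two_le hLc2) hr))
      (δwOf_pos (one_le_of_two_le hLc2) cE cVH cΛ (T2Of_loc (one_le_of_two_le hLc2) cE cVH cΛ ((Lc : ℝ) ^ (2 * (3 + 1))) cB Tc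
        (hB_base (one_le_of_two_le hLc2)) (hmix_an1 (one_le_of_two_le hLc2) hr)) (hmix_an1 (one_le_of_two_le hLc2) hr))
      (WbalOf_loc₂ (one_le_of_two_le hLc2) cE cVH cΛ (T2Of_loc (one_le_of_two_le hLc2) cE cVH cΛ ((Lc : ℝ) ^ (2 * (3 + 1))) cB Tc
        (hB_base (one_le_of_two_le hLc2)) (hmix_an1 (one_le_of_two_le hLc2) hr)) (hmix_an1 (one_le_of_two_le hLc2) hr)) j).S)
    (hW1 : ∀ j, Wt j 1 = WbalOf 3 Lc cE cVH cΛ (T2Of 3 Lc cE cVH cΛ ((Lc : ℝ) ^ (2 * (3 + 1))) cB Tc (vh₂S 3 Lc) (mixFFAt (toSite r) Lc))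
      (mixFFAt (toSite r) Lc) j)
    (hRj : ∀ j, AxisReflectionCovariant (flipK (TbalOf Lc (JsBalT2Of (one_le_of_two_le hLc2) cE cVH cΛ ((Lc : ℝ) ^ (2 * (3 + 1))) cB Tc
      (hB_base (one_le_of_two_le hLc2)) (hmix_an1 (one_le_of_two_le hLc2) hr)) j)))
    (hWj : ∀ j, WardTransversal (flipK (TbalOf Lc (JsBalT2Of (one_le_of_two_le hLc2) cE cVH cΛ ((Lc : ℝ) ^ (2 * (3 + 1))) cB Tc
      (hB_base (one_le_of_two_le hLc2)) (hmix_an1 (one_le_of_two_le hLc2) hr)) j)))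
    (hSinf : ∀ m : ℕ, 2 ≤ m → ∃ Cs' δS' : ℝ, 0 < δS' ∧ LocStencil (SPerfOf (sfStep Lc) (smStep 3 Lc) S m) Cs' δS')
    (hWinf : ∀ m : ℕ, 2 ≤ m → ∃ Cw'' δW' : ℝ, 0 < δW' ∧ VertexFamily₂ (WPerfOf (sfStep Lc) (smStep 3 Lc) Wt m) (Lc ^ m) Cw'' δW')
    (hDA : ∀ m : ℕ, 1 ≤ m → ∀ a b, AbsMoment₂ (D m a b))
    (hfub : ∀ m : ℕ, 1 ≤ m → ∀ (a b : Fin 4) (z : Fin 4 → ℤ),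
      TPerfOf (Lc ^ (m + 1)) (KPerf Lc (sfStep Lc) (smStep 3 Lc) (m + 1)) (SPerfOf (sfStep Lc) (smStep 3 Lc) S (m + 1))
          (WPerfOf (sfStep Lc) (smStep 3 Lc) Wt (m + 1)) a b z
        = ((Lc ^ m : ℕ) : ℝ) ^ 8 * dressedEntry (colOf (KPerf (d := 3) Lc (sfStep Lc) (smStep 3 Lc) m))
            (TPerfOf Lc (KPerf Lc (sfStep Lc) (smStep 3 Lc) 1) (SPerfOf (sfStep Lc) (smStep 3 Lc) S 1) (WPerfOf (sfStep Lc) (smStep 3 Lc) Wt 1))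
            (((Lc ^ m : ℕ) : ℤ) • z) a b
          + TPerfOf (Lc ^ m) (KPerf Lc (sfStep Lc) (smStep 3 Lc) m) (SPerfOf (sfStep Lc) (smStep 3 Lc) S m) (WPerfOf (sfStep Lc) (smStep 3 Lc) Wt m) a b z
          + D m a b z)
    (μ ν : Fin 4) (hSDF : ∀ m : ℕ, 1 ≤ m → secondMoment (D m) μ ν = 0) :
    ∀ m : ℕ, 1 ≤ m → fPerf Lc (sfStep Lc) (smStep 3 Lc) S Wt μ ν (m + 1) =
      fPerf Lc (sfStep Lc) (smStep 3 Lc) S Wt μ ν m + fPerf Lc (sfStep Lc) (smStep 3 Lc) S Wt μ ν 1 := by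
  obtain ⟨Cw, cW, θW, δW, hθW0, hθW1, hδW, hW, hWall⟩ := hW_hWall_three_an1_pinned hLc2 hr cE cVH cΛ cB Tc
  exact fPerf_succ_of_rows_holdsKS (one_le_of_two_le hLc2) cE cVH cΛ _ _ _ _ _ S Wt hLc2 hS1 hW1 hW hWall hδW hθW0 hθW1 hRj hWj hSinf hWinf hDA hfub
    μ ν hSDF

/-- **ROAD «FP», THE END FOR THE PINNED FAMILY — NOTHING FROM ROW G-an2-4 LEFT (bounded-defect form)** (`d = 3`, `2 ≤ Lc`, `r ∈ box (3+1) Lc`):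
`D1Drift Lc (JsBalT2Of …) N μ ν` ⟸ EXACTLY the `m = 1` pins, `hRj` (an2's hR) / `hWj` (an1's hW) at finite `j` FOR THIS COMPOSITE FAMILY, class data of the
free (j, m) jet families for `m ≥ 2`, Fubini∞ `hfub` + `hDA` (N2a), (SDF)∞ `hSDF` (N2b), bounded-defect asymptotics `hasym` (N7).  The left-hand side is the
family of gan24-p1-g5's closing sentence `WSlotT2Tables.d1Drift_iff_three_JsBalT2Of_pinned`.  NOT «D1 closed»: every hypothesis named is OPEN. [our object] -/
theorem d1Drift_JsBalT2Of_pinned_of_rows_bounded (hLc2 : 2 ≤ Lc)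
    (hS1 : ∀ j, S j 1 = (JsBal0Of (one_le_of_two_le hLc2) cE cVH cΛ
      (WbalOf 3 Lc cE cVH cΛ (T2Of 3 Lc cE cVH cΛ ((Lc : ℝ) ^ (2 * (3 + 1))) cB Tc (vh₂S 3 Lc) (mixFFAt (toSite r) Lc)) (mixFFAt (toSite r) Lc))
      (CwOf (one_le_of_two_le hLc2) cE cVH cΛ (T2Of_loc (one_le_of_two_le hLc2) cE cVH cΛ ((Lc : ℝ) ^ (2 * (3 + 1))) cB Tc
        (hB_base (one_le_of_two_le hLc2)) (hmix_an1 (one_le_of_two_le hLc2) hr)) (hmix_an1 (one_le_of_two_le hLc2) hr))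
      (δwOf (one_le_of_two_le hLc2) cE cVH cΛ (T2Of_loc (one_le_of_two_le hLc2) cE cVH cΛ ((Lc : ℝ) ^ (2 * (3 + 1))) cB Tc
        (hB_base (one_le_of_two_le hLc2)) (hmix_an1 (one_le_of_two_le hLc2) hr)) (hmix_an1 (one_le_of_two_le hLc2) hr))
      (δwOf_pos (one_le_of_two_le hLc2) cE cVH cΛ (T2Of_loc (one_le_of_two_le hLc2) cE cVH cΛ ((Lc : ℝ) ^ (2 * (3 + 1))) cB Tc
        (hB_base (one_le_of_two_le hLc2)) (hmix_an1 (one_le_of_two_le hLc2) hr)) (hmix_an1 (one_le_of_two_le hLc2) hr))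
      (WbalOf_loc₂ (one_le_of_two_le hLc2) cE cVH cΛ (T2Of_loc (one_le_of_two_le hLc2) cE cVH cΛ ((Lc : ℝ) ^ (2 * (3 + 1))) cB Tc
        (hB_base (one_le_of_two_le hLc2)) (hmix_an1 (one_le_of_two_le hLc2) hr)) (hmix_an1 (one_le_of_two_le hLc2) hr)) j).S)
    (hW1 : ∀ j, Wt j 1 = WbalOf 3 Lc cE cVH cΛ (T2Of 3 Lc cE cVH cΛ ((Lc : ℝ) ^ (2 * (3 + 1))) cB Tc (vh₂S 3 Lc) (mixFFAt (toSite r) Lc))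
      (mixFFAt (toSite r) Lc) j)
    (hRj : ∀ j, AxisReflectionCovariant (flipK (TbalOf Lc (JsBalT2Of (one_le_of_two_le hLc2) cE cVH cΛ ((Lc : ℝ) ^ (2 * (3 + 1))) cB Tc
      (hB_base (one_le_of_two_le hLc2)) (hmix_an1 (one_le_of_two_le hLc2) hr)) j)))
    (hWj : ∀ j, WardTransversal (flipK (TbalOf Lc (JsBalT2Of (one_le_of_two_le hLc2) cE cVH cΛ ((Lc : ℝ) ^ (2 * (3 + 1))) cB Tc
      (hB_base (one_le_of_two_le hLc2)) (hmix_an1 (one_le_of_two_le hLc2) hr)) j)))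
    (hSinf : ∀ m : ℕ, 2 ≤ m → ∃ Cs' δS' : ℝ, 0 < δS' ∧ LocStencil (SPerfOf (sfStep Lc) (smStep 3 Lc) S m) Cs' δS')
    (hWinf : ∀ m : ℕ, 2 ≤ m → ∃ Cw'' δW' : ℝ, 0 < δW' ∧ VertexFamily₂ (WPerfOf (sfStep Lc) (smStep 3 Lc) Wt m) (Lc ^ m) Cw'' δW')
    (hDA : ∀ m : ℕ, 1 ≤ m → ∀ a b, AbsMoment₂ (D m a b))
    (hfub : ∀ m : ℕ, 1 ≤ m → ∀ (a b : Fin 4) (z : Fin 4 → ℤ),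
      TPerfOf (Lc ^ (m + 1)) (KPerf Lc (sfStep Lc) (smStep 3 Lc) (m + 1)) (SPerfOf (sfStep Lc) (smStep 3 Lc) S (m + 1))
          (WPerfOf (sfStep Lc) (smStep 3 Lc) Wt (m + 1)) a b z
        = ((Lc ^ m : ℕ) : ℝ) ^ 8 * dressedEntry (colOf (KPerf (d := 3) Lc (sfStep Lc) (smStep 3 Lc) m))
            (TPerfOf Lc (KPerf Lc (sfStep Lc) (smStep 3 Lc) 1) (SPerfOf (sfStep Lc) (smStep 3 Lc) S 1) (WPerfOf (sfStep Lc) (smStep 3 Lc) Wt 1))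
            (((Lc ^ m : ℕ) : ℤ) • z) a b
          + TPerfOf (Lc ^ m) (KPerf Lc (sfStep Lc) (smStep 3 Lc) m) (SPerfOf (sfStep Lc) (smStep 3 Lc) S m) (WPerfOf (sfStep Lc) (smStep 3 Lc) Wt m) a b z
          + D m a b z)
    (μ ν : Fin 4) (hSDF : ∀ m : ℕ, 1 ≤ m → secondMoment (D m) μ ν = 0) {N Cg : ℝ}
    (hasym : ∀ m : ℕ, 1 ≤ m → |fPerf Lc (sfStep Lc) (smStep 3 Lc) S Wt μ ν m - (m : ℝ) * stepBal N Lc| ≤ Cg) :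
    D1Drift Lc (JsBalT2Of (one_le_of_two_le hLc2) cE cVH cΛ ((Lc : ℝ) ^ (2 * (3 + 1))) cB Tc (hB_base (one_le_of_two_le hLc2))
      (hmix_an1 (one_le_of_two_le hLc2) hr)) N μ ν := by
  obtain ⟨Cw, cW, θW, δW, hθW0, hθW1, hδW, hW, hWall⟩ := hW_hWall_three_an1_pinned hLc2 hr cE cVH cΛ cB Tc
  exact d1Drift_JsBalOf_of_rows_bounded_holdsKS (one_le_of_two_le hLc2) cE cVH cΛ _ _ _ _ _ S Wt hLc2 hS1 hW1 hW hWall hδW hθW0 hθW1 hRj hWj hSinf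
    hWinf hDA hfub μ ν hSDF hasym

/-- **THE CELL's END STATEMENT FROM ROAD «FP» FOR THE PINNED FAMILY — NOTHING FROM ROW G-an2-4 LEFT**: `EndpointExistence Cn` BY TYPE from the pins, `hRj`/`hWj`
(this family), class data (`m ≥ 2`), Fubini∞, (SDF)∞, bounded-defect asymptotics, `hβ` (the one-loop split is the pinned family's second moment), (D4) `RemainderConst`
with `rr ≤ stepBal`, (C), `hgen` — `StepLawKHolds.endpointExistence_of_rows_bounded` with both slot pairs supplied BY NAME.  NOT the continuum limit's
construction. [our object] -/
theorem endpointExistence_JsBalT2Of_pinned_of_rows_bounded (hLc2 : 2 ≤ Lc)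
    (hS1 : ∀ j, S j 1 = (JsBal0Of (one_le_of_two_le hLc2) cE cVH cΛ
      (WbalOf 3 Lc cE cVH cΛ (T2Of 3 Lc cE cVH cΛ ((Lc : ℝ) ^ (2 * (3 + 1))) cB Tc (vh₂S 3 Lc) (mixFFAt (toSite r) Lc)) (mixFFAt (toSite r) Lc))
      (CwOf (one_le_of_two_le hLc2) cE cVH cΛ (T2Of_loc (one_le_of_two_le hLc2) cE cVH cΛ ((Lc : ℝ) ^ (2 * (3 + 1))) cB Tc
        (hB_base (one_le_of_two_le hLc2)) (hmix_an1 (one_le_of_two_le hLc2) hr)) (hmix_an1 (one_le_of_two_le hLc2) hr))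
      (δwOf (one_le_of_two_le hLc2) cE cVH cΛ (T2Of_loc (one_le_of_two_le hLc2) cE cVH cΛ ((Lc : ℝ) ^ (2 * (3 + 1))) cB Tc
        (hB_base (one_le_of_two_le hLc2)) (hmix_an1 (one_le_of_two_le hLc2) hr)) (hmix_an1 (one_le_of_two_le hLc2) hr))
      (δwOf_pos (one_le_of_two_le hLc2) cE cVH cΛ (T2Of_loc (one_le_of_two_le hLc2) cE cVH cΛ ((Lc : ℝ) ^ (2 * (3 + 1))) cB Tc
        (hB_base (one_le_of_two_le hLc2)) (hmix_an1 (one_le_of_two_le hLc2) hr)) (hmix_an1 (one_le_of_two_le hLc2) hr))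
      (WbalOf_loc₂ (one_le_of_two_le hLc2) cE cVH cΛ (T2Of_loc (one_le_of_two_le hLc2) cE cVH cΛ ((Lc : ℝ) ^ (2 * (3 + 1))) cB Tc
        (hB_base (one_le_of_two_le hLc2)) (hmix_an1 (one_le_of_two_le hLc2) hr)) (hmix_an1 (one_le_of_two_le hLc2) hr)) j).S)
    (hW1 : ∀ j, Wt j 1 = WbalOf 3 Lc cE cVH cΛ (T2Of 3 Lc cE cVH cΛ ((Lc : ℝ) ^ (2 * (3 + 1))) cB Tc (vh₂S 3 Lc) (mixFFAt (toSite r) Lc))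
      (mixFFAt (toSite r) Lc) j)
    (hRj : ∀ j, AxisReflectionCovariant (flipK (TbalOf Lc (JsBalT2Of (one_le_of_two_le hLc2) cE cVH cΛ ((Lc : ℝ) ^ (2 * (3 + 1))) cB Tc
      (hB_base (one_le_of_two_le hLc2)) (hmix_an1 (one_le_of_two_le hLc2) hr)) j)))
    (hWj : ∀ j, WardTransversal (flipK (TbalOf Lc (JsBalT2Of (one_le_of_two_le hLc2) cE cVH cΛ ((Lc : ℝ) ^ (2 * (3 + 1))) cB Tc
      (hB_base (one_le_of_two_le hLc2)) (hmix_an1 (one_le_of_two_le hLc2) hr)) j)))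
    (hSinf : ∀ m : ℕ, 2 ≤ m → ∃ Cs' δS' : ℝ, 0 < δS' ∧ LocStencil (SPerfOf (sfStep Lc) (smStep 3 Lc) S m) Cs' δS')
    (hWinf : ∀ m : ℕ, 2 ≤ m → ∃ Cw'' δW' : ℝ, 0 < δW' ∧ VertexFamily₂ (WPerfOf (sfStep Lc) (smStep 3 Lc) Wt m) (Lc ^ m) Cw'' δW')
    (hDA : ∀ m : ℕ, 1 ≤ m → ∀ a b, AbsMoment₂ (D m a b))
    (hfub : ∀ m : ℕ, 1 ≤ m → ∀ (a b : Fin 4) (z : Fin 4 → ℤ),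
      TPerfOf (Lc ^ (m + 1)) (KPerf Lc (sfStep Lc) (smStep 3 Lc) (m + 1)) (SPerfOf (sfStep Lc) (smStep 3 Lc) S (m + 1))
          (WPerfOf (sfStep Lc) (smStep 3 Lc) Wt (m + 1)) a b z
        = ((Lc ^ m : ℕ) : ℝ) ^ 8 * dressedEntry (colOf (KPerf (d := 3) Lc (sfStep Lc) (smStep 3 Lc) m))
            (TPerfOf Lc (KPerf Lc (sfStep Lc) (smStep 3 Lc) 1) (SPerfOf (sfStep Lc) (smStep 3 Lc) S 1) (WPerfOf (sfStep Lc) (smStep 3 Lc) Wt 1))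
            (((Lc ^ m : ℕ) : ℤ) • z) a b
          + TPerfOf (Lc ^ m) (KPerf Lc (sfStep Lc) (smStep 3 Lc) m) (SPerfOf (sfStep Lc) (smStep 3 Lc) S m) (WPerfOf (sfStep Lc) (smStep 3 Lc) Wt m) a b z
          + D m a b z)
    (μ ν : Fin 4) (hSDF : ∀ m : ℕ, 1 ≤ m → secondMoment (D m) μ ν = 0) {N Cg : ℝ}
    (hasym : ∀ m : ℕ, 1 ≤ m → |fPerf Lc (sfStep Lc) (smStep 3 Lc) S Wt μ ν m - (m : ℝ) * stepBal N Lc| ≤ Cg)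
    {β : HBeta} {Cn : B12.Construction} (hgen : ForwardGenerated Cn β) (Sβ : B12Beta.OneLoopSplit β)
    (hβ : ∀ j, Sβ.β0 j = B12Beta.secondMoment (TbalOf Lc (JsBalT2Of (one_le_of_two_le hLc2) cE cVH cΛ ((Lc : ℝ) ^ (2 * (3 + 1))) cB Tc
      (hB_base (one_le_of_two_le hLc2)) (hmix_an1 (one_le_of_two_le hLc2) hr)) j) μ ν)
    {rr γ₀ : ℝ} (hγ₀ : 0 < γ₀) (hrem : RemainderConst Sβ γ₀ rr) (hr' : rr ≤ stepBal N Lc) (hcont : BetaContH γ₀ β) :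
    EndpointExistence Cn := by
  obtain ⟨Cw, cW, θW, δW, hθW0, hθW1, hδW, hW, hWall⟩ := hW_hWall_three_an1_pinned hLc2 hr cE cVH cΛ cB Tc
  obtain ⟨Cs, cS, θS, δS, hθS0, hθS1, hδS, hS, hSall⟩ := hS_hSall_three hLc2 cE cVH cΛ
    (WbalOf 3 Lc cE cVH cΛ (T2Of 3 Lc cE cVH cΛ ((Lc : ℝ) ^ (2 * (3 + 1))) cB Tc (vh₂S 3 Lc) (mixFFAt (toSite r) Lc)) (mixFFAt (toSite r) Lc)) _ _
    (δwOf_pos (one_le_of_two_le hLc2) cE cVH cΛ (T2Of_loc (one_le_of_two_le hLc2) cE cVH cΛ ((Lc : ℝ) ^ (2 * (3 + 1))) cB Tc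
        (hB_base (one_le_of_two_le hLc2)) (hmix_an1 (one_le_of_two_le hLc2) hr)) (hmix_an1 (one_le_of_two_le hLc2) hr))
    (WbalOf_loc₂ (one_le_of_two_le hLc2) cE cVH cΛ (T2Of_loc (one_le_of_two_le hLc2) cE cVH cΛ ((Lc : ℝ) ^ (2 * (3 + 1))) cB Tc
        (hB_base (one_le_of_two_le hLc2)) (hmix_an1 (one_le_of_two_le hLc2) hr)) (hmix_an1 (one_le_of_two_le hLc2) hr))
  exact endpointExistence_of_rows_bounded (one_le_of_two_le hLc2) cE cVH cΛ _ _ _ _ _ S Wt hLc2 hS1 hW1 hS hSall hW hWall hδS hδW hθS0 hθS1 hθW0 hθW1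
    hRj hWj hSinf hWinf hDA hfub μ ν hSDF hasym hgen Sβ hβ hγ₀ hrem hr' hcont

end Pinned

end

end Summit.QuantumFields.BalabanUV.Beta.FP.RoadPinnedHolds
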